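import Summits.QuantumFields.YangMills.Theses.BalabanUVNodes
import Summits.QuantumFields.YangMills.Theorems.BalabanUVNodesN27AtBothReadingsOfRecord13CoPHV

/-!
# ★ V EDITION (dag-n20-d `Thm/BalabanUVNodesSpineReadingOfRecord13CoPHV` p590105 ✓ 00:36Z 2026-08-28: `crOfRecord₁₃VAt K₀ jcut sh` ∕ `crOfRecord₁₃V`, the reading of record WITH THE PHYSICAL
# VOLUME LETTER `vol := F.side ^ 4` — «the RECORD pointer is the V edition; the v3 re-point of `PinnedAtLive` is this one token», pub-ymgap INBOX l.25713) = the token image of this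
# lineage's v1.0-reading module under `crOfRecord₁₃At ↦ crOfRecord₁₃VAt`, `NE7.Core 1 1 ↦ NE7.Core 1 (F.side ^ 4)` (the witness form of the N19′ edge), face lemmas `…_crOfRecord₁₃At ↦ …VAt`;
# every carrier but `vol`∕`δ` is shared by `rfl` (`crOfRecord₁₃VAt_T_eq`); statements and proofs otherwise VERBATIM; the v1.0 module stays as landed.
# BalabanUVNodes ∕ N27 = binder B5 AT THE RECORD, leaf I — ★ K3⁷ `Theses.BalabanUVNodes.SpineGivenEndpointR13SepCoPH` BY NAME AT **BOTH READINGS OF RECORD ON THE LIVE-SELECTOR LINE**: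
# node00-def-W1's ADMISSIBLE `CoPH` rate reading (every K4 slot in its producer's deepest landed currency; N16 R-β; N14 DISCHARGED at dag-n14-w1's unit-scale assignment; N17 eliminated)
# everywhere on the guard, and dag-n20-d's spine reading `crOfRecord₁₃VAt K₀ jcut sh` ON THE LIVE LINE (every K5 slot in the definer's currency: keyed N20 ∕ N21 ∕ N19′ WITNESSES at the
# reading's named carriers, extraction = `keyedExtraction_crOfRecord₁₃VAt` under the laws, the selector pin READ OFF THE LINE) with leaf G's `cr`-parametric K5 binders at a FREE `cr'` OFF
# the live line (K3⁷ skeleton v2's `PinnedAtLive` shape, registered 00:03Z 2026-08-28; plan g79 Q-SEL l.25357) — (V) `…N27AtBothReadingsOfRecord13CoPHV` at `Rg := guard ∧ LiveSel` and (T2)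
# `…HolderUnitScaleN14Producers` at `cr'`, `Rg := guard ∧ ¬LiveSel`, joined by (U) `spine_rec13CCoPHOn_of_split`; `N = 2`, `hc := hP.toCore`; a ninth route-facing leaf, nothing may import it
# (cell `pub-ymgap`, HUMAN RULING D-0062 Track A, R134 seat `pub-ymgap-dag-n27-c` (s2 «ONE discharge-shaped theorem») gen 11; `--kind proof --supports stmt-QuantumFields-20544 --as helper`;
# COUNT-NEUTRAL)

WHAT IS KERNEL-CHECKED ([bookkeeping]; ONE theorem, 0 `def`, 0 `sorry`): ★★★ `spineGivenEndpointR13SepCoPH_atBothReadingsOfRecord₁₃CoPHV_holder_pinnedAtLive : … → SpineGivenEndpointR13SepCoPH` —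
THE ITEM as a term under displayed hypotheses = today's K3⁷ reduction BY NAME: β ∈ [0,1]; N16's Thm 3.3 frame `hg₃ hD h7` (N05∕N06∕N07); W1's admissible tables `S sp gauge hg T₀ hT₀ li` +
`hjunk hnum hstrip` (N22 ⟸ N18); the N18 closed form `h18`; (D4) `hD4`; the reading equations `hne2` (N15, c2Bg) and `hne1` (N14, unit scale); ON THE LIVE LINE the laws `hU hζm hζ0`, the keyed
N20 ∕ N21 witnesses `h20 h21` at `classSet₁₃ ∕ weightA₁₃ ∕ weightB₁₃ ∕ badClass₁₃ ∕ sh` and the N19′ edge `h19` ∀ ℓ₃ in witness form; OFF THE LIVE LINE leaf G's `h20' h21' hx' h19'` at `cr'`.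

HONEST FRAMING.  NOT a discharge: a term of the item's type under displayed hypotheses (audit `proof.conditional`), every one inhabited for no family today (K0⁷ `Record13SepCoPHInhabited`
OPEN); the selector is pinned NOWHERE by this leaf (the live line is a regime, the off-line tuples are served by a free `cr'` — whether they exist or get excluded by a later record edition is
plan g79 Q-SEL, undecided here); the unit-scale reading of N14 is the director's ADOPTED TABLE READING (a); `sh` NOT inhabited (NODE O), `jcut` unpinned; NE1′–NE9 ∕ NE7 ∕ NE7b ∕ NE7c
NOT PRINTED for d = 4 and NOT PROVED at Bałaban's objects; the N15 family is MODEL-level; Thm 3.3 ∕ dictionary ∕ letters ∕ `LeafH3sup` are nodes N05∕N06∕N07's open obligations; nothing of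
Bałaban's asserted or instantiated; N27 COMPOSITE, NOT discharged; K3⁷ NOT claimed closed; route rev 25 and the skeleton of record UNTOUCHED; counts UNMOVED (typed 28∕28 · discharged 5∕27,
A 5∕28); one finite four-torus programme at fixed `ε` — NOT ℝ⁴, NOT infinite volume, NOT OS, NOT a mass gap, NOT Clay.  No decl below carries a cite tag.
-/

set_option autoImplicit false

namespace Summit.QuantumFields.YangMills.Theorems.BalabanUVNodesN27SpineRecord

open Set Metric
open scoped Matrix.Norms.L2Operator

open Literature.MathematicalPhysics.QuantumFieldTheory.Balaban1983to89
open Literature.MathematicalPhysics.QuantumFieldTheory.Balaban1983to89.T4Continuum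
open Literature.MathematicalPhysics.QuantumFieldTheory.Balaban1983to89.T4OutputRate (Carriers Functional NE5 DecayBound Window)
open Literature.MathematicalPhysics.QuantumFieldTheory.Balaban1983to89.TreeLengthTorus (TDom tsys torusTreeLen)
open Literature.MathematicalPhysics.QuantumFieldTheory.Balaban1983to89.T4InputCauchyRateData (StepModel)
open Literature.MathematicalPhysics.QuantumFieldTheory.Balaban1983to89.B13Resummation (locE)
open Literature.MathematicalPhysics.QuantumFieldTheory.Balaban1983to89.TreeLengthTorusGeometry (TTouch)
open Literature.MathematicalPhysics.QuantumFieldTheory.Balaban1983to89.B12TreeDecay (K₀)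
open Summit.QuantumFields.BalabanUV.T4Continuum.Spine.NE5
open YMDAG.N18.HLayer
open YMDAG.N18.W1Reading (s_N18_rRec₁₃CoPH_readingAdm_of_envelope_bound238_pin n18At_u3OfRecord₁₃_readingAdm_iff)
open T4ContinuumYM4Torus (ForSmallCouplings)
open Summit.QuantumFields.BalabanUV.T4Continuum.Spine
open YMDAG.UVSplit
open Node00 (Stage13HParams datumOfRecord₁₃CoPH IsRecordOfRecord₁₃CCoPH IsDatumOfRecord₁₃CCoPH NE3Letters₁₁ NE2Objects₁₁ ne3ConstLayerOfRecord₁₁ MatA ιSU prependCoupling)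
open Node00.Sect2 (domCount domSys CPair ofBackgroundC)
open Node00.W1 (ReadingData LevelPairing LetterInputs ClusterTower pairOfRecord functionalC termC box SpRestr AdmBg)
open YMDAG.N22 (s_N22_readingOfRecord₁₃CoPH_ofRecordAdm_of_s_N18_analytic s_N22_readingOfRecord₁₃CoPHOn_ofRecordAdm_of_s_N18_stripBound)
open B7Prop1Explicit B7Prop2Explicit
open B8Ineq132 (InAk covDerivFwd)
open B8LeafModelZd (ZdIdx)
open B8SockLettersRD (SockLettersRD)
open B7Eq78Linearization (zdBlocking QprimeIter)
open B8Eq119TwistedAxial (bgT)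
open B8Eq140Level (SideTouches)
open B8Eq138LandauZd (covLap QT)
open B8Eq1117Concrete (XSpace)
open B8Prop5ContractionKLevel (Bd2)
open B8LambdaSpaceKLevel (wt)
open B9SupplySockB9P3ZdLetters (OpsZd)
open B9SupplySockB9P3ZdAt (DictAt Prop6At InvAt CurvAt LandauAt AvgAt HolderAt)
open Node00 (ne3NperOfRecord₁₁ ne3DomOfRecord₁₁)
open Summit.QuantumFields.BalabanUV.T4Continuum.NE3.LeafIndexSockets (LeafH3sup)
open YMDAG.N14.TopBorn (ne1UnitScale)
open T4WeightBudget (RelWeightBound)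
open T4IndicatorShell (ShellWeightBound)
open Literature.MathematicalPhysics.QuantumFieldTheory.Balaban1983to89.Node00 (ppSelLiveOfRecord wOfRecord₉ EOfRecord₁₃ LocalBgMeasurable ZetaMeasurable SiteSeqKey)
open Summit.QuantumFields.YangMills.BalabanUVNodes.N19TargetClassWeightsE1Keyed
open Summit.QuantumFields.YangMills.BalabanUVNodes.N15.AtKeyedHome (neZero_blockFactor)
open Summit.QuantumFields.YangMills.BalabanUVNodes.N15.UnitLayerBg (c2BgObjects)
open Summit.QuantumFields.YangMills.BalabanUVNodes.N15.AtReadingOfRecord13CoPH (s_N15_readingOfRecord₁₃CoPH_of_c2Bg_family s_N15_readingOfRecord₁₃CoPHOn_of_c2Bg_family)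
open Summit.QuantumFields.YangMills.BalabanUVNodes.SpineRatesHolder (RatesHolderAt)
open Summit.QuantumFields.YangMills.BalabanUVNodes.N16OfThm33LettersAllTorusAtRecord13CoPH (exists_letters_s_N16Holder_readingOfRecord₁₃CoPHOn_of_thm33Letters_allTorus)
open Summit.QuantumFields.YangMills.Theses.BalabanUVNodes (SpineGivenEndpointR13SepCoPH)

variable (K₀ : ℕ) (jcut : ℕ → ℕ) (sh : ShellSplit₁₃CoPH 2 K₀)
  (cr' : (F : T4Family) → (θ : Stage13HParams F 2) → θ.Provisos₁₃CoPH F 2 → (ℕ → ℝ) → List (ULoop F) → SpineCarriers)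
  
  (S : (F : T4Family) → (θ : Stage13HParams F 2) → (k : ℕ) → ClusterTower (F.P k) (MatA 2) θ.τ9.M)
  (sp : (F : T4Family) → (θ : Stage13HParams F 2) → (k j : ℕ) → (domSys (F.P k) θ.τ9.M j).Dom → Set (CPair (F.P k) (MatA 2)))
  (gauge : (F : T4Family) → (θ : Stage13HParams F 2) → (k : ℕ) → GaugeField (F.P k) 0 (Node00.SU 2) → GaugeField (F.P k) 0 (Node00.SU 2) → ℝ)
  (hg : ∀ (F : T4Family) (θ : Stage13HParams F 2) (k : ℕ) (U U' : GaugeField (F.P k) 0 (Node00.SU 2)), 0 ≤ gauge F θ k U U')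
  (T₀ : (F : T4Family) → (θ : Stage13HParams F 2) → (k : ℕ) → GaugeField (F.P (k + 1)) 0 (Node00.SU 2) → GaugeField (F.P k) 0 (Node00.SU 2))
  (hT₀ : ∀ (F : T4Family) (θ : Stage13HParams F 2) (k : ℕ) (U : GaugeField (F.P (k + 1)) 0 (Node00.SU 2)),
    (∀ (j : ℕ) (Y : (domSys (F.P (k + 1)) θ.τ9.M j).Dom), ofBackgroundC (ιSU 2) U ∈ sp F θ (k + 1) j Y) →
      ∀ (j : ℕ) (X : (domSys (F.P k) θ.τ9.M j).Dom), ofBackgroundC (ιSU 2) (T₀ F θ k U) ∈ sp F θ k j X)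
  (li : (F : T4Family) → Stage13HParams F 2 → LetterInputs)
  (ne2 : (F : T4Family) → Stage13HParams F 2 → (ℕ → ℝ) → List (ULoop F) → ℕ → NE2Objects₁₁)
  (ne1 : (F : T4Family) → Stage13HParams F 2 → (ℕ → ℝ) → List (ULoop F) → NE1pCarriers)

/-- ★★★ **K3⁷ BY NAME AT BOTH READINGS OF RECORD, THE SPINE READING PINNED ON THE LIVE-SELECTOR LINE** (`N = 2`; (V) `spine_rec13CCoPHOn_atBothReadingsOfRecord₁₃CoPHV_holder` at
`Rg := guard ∧ LiveSel` with `hsel` read off the regime, (T2) `spine_rec13CCoPHOn_at_readingAdm₁₃CoPH_holder_of_unitScaleN14_c2Bg_thm33Letters` at `cr'`, `Rg := guard ∧ ¬LiveSel`, (U)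
`spine_rec13CCoPHOn_of_split`, `hc := hP.toCore`): every K4 slot at node00-def-W1's admissible rate reading on the whole guard, every K5 slot in dag-n20-d's currency at
`crOfRecord₁₃VAt K₀ jcut sh` on the live line, leaf G's binders at `cr'` off it.  NOT a discharge: a term of the item's type under displayed hypotheses, each inhabited for no family today;
nothing of Bałaban's run is asserted to be any of the named readings; the selector is pinned nowhere. [bookkeeping] -/
theorem spineGivenEndpointR13SepCoPH_atBothReadingsOfRecord₁₃CoPHV_holder_pinnedAtLive
    {β : ℝ} (hβ0 : 0 ≤ β) (hβ1 : β ≤ 1) {g₃ : T4Family → ℝ} (hg₃ : ∀ F, 0 < g₃ F)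
  (hD : ∀ F : T4Family, letI : CStarAlgebra (Matrix (Fin 2) (Fin 2) ℂ) := {}
      ∃ (len : Site 4 → ℝ) (I : Type) (geo : I → B9.Geometry) (bg : I → B9.Backgrounds) (GA Gp : ∀ i, B9.KernelFamily (geo i) (bg i)) (c35 : ℝ)
        (mem : ℝ → ZdIdx 4 F.L → ℕ → I)
        (ιCfg : ∀ (M : ℝ) (i : ZdIdx 4 F.L) (m : ℕ) (U₀ : Site 4 → Fin 4 → (Matrix (Fin 2) (Fin 2) ℂ)ˣ), (∀ x κ, U₀ x κ ∈ unitaryUnits (Matrix (Fin 2) (Fin 2) ℂ)) → (bg (mem M i m)).Cfg)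
        (ιLoc : ∀ (M : ℝ) (i : ZdIdx 4 F.L) (m : ℕ), (Site 4 → Fin 4 → Matrix (Fin 2) (Fin 2) ℂ) → (geo (mem M i m)).Loc)
        (ops : ℝ → ZdIdx 4 F.L → ℕ → OpsZd 4 (Matrix (Fin 2) (Fin 2) ℂ)) (c₆ K₆ M₃ a₃ c69 q CH B₀'H B₂' BG BR cL : ℝ),
        (∀ v : Site 4, 0 < len v → 1 ≤ len v) ∧ (∀ μ : Fin 4, len (e μ) = 1) ∧
        B9.Thm33Printed c35 geo bg Gp GA ∧
        0 < c₆ ∧ 0 < K₆ ∧ 0 < a₃ ∧ 0 ≤ c69 ∧ 0 ≤ q ∧ 0 < B₀'H ∧ 0 ≤ B₂' ∧ 0 ≤ BG ∧ 0 ≤ BR ∧ 0 < cL ∧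
        (∀ (M : ℝ) (i : {i : ZdIdx 4 F.L // (∀ j, i.Ω j = Set.univ) ∧ (∀ m j, i.Λs m j = {_y | j = m}) ∧ (∀ m j, i.Λb m j = {_c | j = m}) ∧ i.η = ((F.L : ℝ)⁻¹) ^ i.k}) (m : ℕ), DictAt geo bg GA F.L mem ιCfg ιLoc ops M i.1 m) ∧
        (∀ (M : ℝ) (i : {i : ZdIdx 4 F.L // (∀ j, i.Ω j = Set.univ) ∧ (∀ m j, i.Λs m j = {_y | j = m}) ∧ (∀ m j, i.Λb m j = {_c | j = m}) ∧ i.η = ((F.L : ℝ)⁻¹) ^ i.k}) (m : ℕ), M₃ ≤ M → Prop6At bg F.L mem ιCfg c35 c₆ K₆ M i.1 m) ∧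
        (∀ (M : ℝ) (i : {i : ZdIdx 4 F.L // (∀ j, i.Ω j = Set.univ) ∧ (∀ m j, i.Λs m j = {_y | j = m}) ∧ (∀ m j, i.Λb m j = {_c | j = m}) ∧ i.η = ((F.L : ℝ)⁻¹) ^ i.k}) (m : ℕ), M₃ ≤ M → InvAt bg F.L mem ιCfg ops c35 a₃ M i.1 m) ∧
        (∀ (M : ℝ) (i : {i : ZdIdx 4 F.L // (∀ j, i.Ω j = Set.univ) ∧ (∀ m j, i.Λs m j = {_y | j = m}) ∧ (∀ m j, i.Λb m j = {_c | j = m}) ∧ i.η = ((F.L : ℝ)⁻¹) ^ i.k}) (m : ℕ), M₃ ≤ M → CurvAt bg F.L mem ιCfg ops c35 a₃ c69 M i.1 m) ∧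
        (∀ (M : ℝ) (i : {i : ZdIdx 4 F.L // (∀ j, i.Ω j = Set.univ) ∧ (∀ m j, i.Λs m j = {_y | j = m}) ∧ (∀ m j, i.Λb m j = {_c | j = m}) ∧ i.η = ((F.L : ℝ)⁻¹) ^ i.k}) (m : ℕ), M₃ ≤ M → LandauAt bg F.L mem ιCfg ops c35 a₃ M i.1 m) ∧
        (∀ (M : ℝ) (i : {i : ZdIdx 4 F.L // (∀ j, i.Ω j = Set.univ) ∧ (∀ m j, i.Λs m j = {_y | j = m}) ∧ (∀ m j, i.Λb m j = {_c | j = m}) ∧ i.η = ((F.L : ℝ)⁻¹) ^ i.k}) (m : ℕ), AvgAt F.L ops q M i.1 m) ∧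
        (∀ (M : ℝ) (i : {i : ZdIdx 4 F.L // (∀ j, i.Ω j = Set.univ) ∧ (∀ m j, i.Λs m j = {_y | j = m}) ∧ (∀ m j, i.Λb m j = {_c | j = m}) ∧ i.η = ((F.L : ℝ)⁻¹) ^ i.k}) (m : ℕ), HolderAt geo bg GA F.L mem ιCfg ops β len CH M i.1 m) ∧
        (∀ i : {i : ZdIdx 4 F.L // (∀ j, i.Ω j = Set.univ) ∧ (∀ m j, i.Λs m j = {_y | j = m}) ∧ (∀ m j, i.Λb m j = {_c | j = m}) ∧ i.η = ((F.L : ℝ)⁻¹) ^ i.k}, SockLettersRD (𝔸 := Matrix (Fin 2) (Fin 2) ℂ) F.L BG BR B₀'H B₂' cL i.1.η i.1.k i.1.Ω i.1.Λs) ∧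
        (∀ i : {i : ZdIdx 4 F.L // (∀ j, i.Ω j = Set.univ) ∧ (∀ m j, i.Λs m j = {_y | j = m}) ∧ (∀ m j, i.Λb m j = {_c | j = m}) ∧ i.η = ((F.L : ℝ)⁻¹) ^ i.k}, ∀ α₀ : ℝ, 0 < α₀ → α₀ ≤ cL → ∀ U₀ : Site 4 → Fin 4 → (Matrix (Fin 2) (Fin 2) ℂ)ˣ, (∀ x κ, U₀ x κ ∈ unitaryUnits (Matrix (Fin 2) (Fin 2) ℂ)) →
          InAk F.L i.1.k i.1.η α₀ i.1.Ω U₀ →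
          ∃ (g Δ : (Site 4 → Matrix (Fin 2) (Fin 2) ℂ) →ₗ[ℂ] (Site 4 → Matrix (Fin 2) (Fin 2) ℂ)) (q : (Site 4 → Matrix (Fin 2) (Fin 2) ℂ) →ₗ[ℂ] (ℕ → Site 4 → Matrix (Fin 2) (Fin 2) ℂ))
            (qs : (ℕ → Site 4 → Matrix (Fin 2) (Fin 2) ℂ) →ₗ[ℂ] (Site 4 → Matrix (Fin 2) (Fin 2) ℂ)) (Aw c : (ℕ → Site 4 → Matrix (Fin 2) (Fin 2) ℂ) →ₗ[ℂ] (ℕ → Site 4 → Matrix (Fin 2) (Fin 2) ℂ))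
            (H' : XSpace 4 i.1.k (Matrix (Fin 2) (Fin 2) ℂ) →ₗ[ℂ] (Site 4 → Matrix (Fin 2) (Fin 2) ℂ)),
            (∀ x : Site 4 → Matrix (Fin 2) (Fin 2) ℂ, (∃ C : ℝ, ∀ y, ‖x y‖ ≤ C) → g (Δ x + qs (Aw (q x))) = x) ∧ (∀ φ, qs (c (q (g (g (qs φ))))) = qs φ) ∧
            (∀ (f : Site 4 → Matrix (Fin 2) (Fin 2) ℂ), ∀ x ∈ i.1.Ω 0, Δ f x = covLap i.1.η U₀ ((i.1.Ω 0).indicator f) x) ∧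
            (∀ (μ : ℕ → Site 4 → Matrix (Fin 2) (Fin 2) ℂ), ∀ x ∈ i.1.Ω 0, qs μ x = QT F.L i.1.k (i.1.Λs i.1.k) U₀ μ x) ∧
            (∀ (f : Site 4 → Matrix (Fin 2) (Fin 2) ℂ) (n : ℕ), n ≤ i.1.k → ∀ y ∈ i.1.Λs i.1.k n, q f n y = QprimeIter (zdBlocking 4 F.L) (bgT F.L U₀) n f y) ∧
            (∀ (f : Site 4 → Matrix (Fin 2) (Fin 2) ℂ) (n : ℕ) (y : Site 4), ¬ (n ≤ i.1.k ∧ y ∈ i.1.Λs i.1.k n) → q f n y = 0) ∧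
            (∀ (X : XSpace 4 i.1.k (Matrix (Fin 2) (Fin 2) ℂ)) (x : Site 4), ‖H' X x‖ ≤ B₀'H * ‖X‖) ∧
            (∀ n, n ≤ i.1.k → ∀ (X : XSpace 4 i.1.k (Matrix (Fin 2) (Fin 2) ℂ)), ∀ p ∈ {b : Site 4 × Fin 4 | SideTouches (i.1.Ω n) b.1 b.2},
              wt F.L i.1.η n * ‖covDerivFwd i.1.η U₀ p.2 (H' X) p.1‖ ≤ B₀'H * ‖X‖) ∧
            (∀ X : XSpace 4 i.1.k (Matrix (Fin 2) (Fin 2) ℂ), Bd2 F.L i.1.η i.1.k i.1.Ω (covLap i.1.η U₀ (H' X)) (B₂' * ‖X‖)) ∧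
            (∀ (Y : XSpace 4 i.1.k (Matrix (Fin 2) (Fin 2) ℂ)) (n : ℕ) (hn : n ≤ i.1.k) (y : Site 4), y ∈ i.1.Λs i.1.k n →
              QprimeIter (zdBlocking 4 F.L) (bgT F.L U₀) n (H' Y) y = Y (⟨n, Nat.lt_succ_of_le hn⟩, y)) ∧
            (∀ (f : Site 4 → Matrix (Fin 2) (Fin 2) ℂ) (r : ℝ), 0 ≤ r → Bd2 F.L i.1.η i.1.k i.1.Ω f r →
              (∀ x, ‖g f x‖ ≤ BG * r) ∧ ∀ n, n ≤ i.1.k → ∀ p ∈ {b : Site 4 × Fin 4 | SideTouches (i.1.Ω n) b.1 b.2},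
                wt F.L i.1.η n * ‖covDerivFwd i.1.η U₀ p.2 (g f) p.1‖ ≤ BG * r) ∧
            (∀ (f : Site 4 → Matrix (Fin 2) (Fin 2) ℂ) (r : ℝ), 0 ≤ r → Bd2 F.L i.1.η i.1.k i.1.Ω f r → Bd2 F.L i.1.η i.1.k i.1.Ω (f - g (qs (c (q (g f))))) (BR * r))))
  (h7 : ∀ F : T4Family, ∃ C ε₀ : ℝ, 0 ≤ C ∧ 0 < ε₀ ∧ ∀ ε : ℝ, 0 < ε → ε ≤ ε₀ →
      LeafH3sup 4 F.L (ne3NperOfRecord₁₁ F 0 0) ε (C * ε) (C * ε) (ne3DomOfRecord₁₁ F 2 0 0))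
    {l₀ M Λ : ℝ} (hl₀ : 0 ≤ l₀) (hM : 0 ≤ M) (hΛ : 0 ≤ Λ) {b aS : ℝ} (hb : 0 < b) (haS : 0 < aS) {c35 : ℝ} (hc35 : 0 < c35) (α α' : Fin 4) (p : ℝ)
    (h18 : ∀ (F : T4Family) (θ : Stage13HParams F 2), θ.Provisos₁₃CoPH F 2 → (θ.ZhUnity F 2 ∧ θ.SlotsNondegenerate₁₃ F 2) → θ.Admissible F 2 → ∀ (k : ℕ) (b : ℝ), 0 < b → b ≤ θ.γ →
      ∀ g ∈ Window θ.γ,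
        ∀ (U : {U : GaugeField (F.P (k + 1)) 0 (Node00.SU 2) //
            ∀ (j : ℕ) (Y : (domSys (F.P (k + 1)) θ.τ9.M j).Dom), ofBackgroundC (ιSU 2) U ∈ sp F θ (k + 1) j Y})
          (X : Node00.W1.Dom (F.P k) θ.τ9.M),
        |(functionalC (S F θ k) g (ofBackgroundC (ιSU 2) (T₀ F θ k U.1)) X).re -
            (functionalC (S F θ (k + 1)) (prependCoupling b g) (ofBackgroundC (ιSU 2) U.1) (pairOfRecord F θ.τ9.M k X)).re| ≤
          (li F θ).C₅ * (li F θ).θ₅ ^ X.1 * Real.exp (-((li F θ).κ * (domSys (F.P k) θ.τ9.M X.1).dj X.2)))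
    -- N22 ⟸ N18 (dag-n22-e module 8a″, STRIP currency on the reading's OWN table, NO readings clause): (J), twelve numerals, STRIP-(1.18) — verbatim
    (hjunk : ∀ (F : T4Family) (θ : Stage13HParams F 2), θ.Provisos₁₃CoPH F 2 → (θ.ZhUnity F 2 ∧ θ.SlotsNondegenerate₁₃ F 2) → θ.Admissible F 2 →
      ∀ (k : ℕ) (X : Node00.W1.Dom (F.P k) θ.τ9.M), k < X.1 → ∀ (g : ℕ → ℝ) (φ : CPair (F.P k) (MatA 2)), functionalC (S F θ k) g φ X = 0)
    (hnum : ∀ (F : T4Family) (θ : Stage13HParams F 2), θ.Provisos₁₃CoPH F 2 → (θ.ZhUnity F 2 ∧ θ.SlotsNondegenerate₁₃ F 2) → θ.Admissible F 2 →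
      0 < (li F θ).C₀ ∧ 0 < (li F θ).θ₅ ∧ (li F θ).θ₅ < 1 ∧ 0 ≤ (li F θ).C₅ ∧ 2 * (li F θ).C₅ / (1 - (li F θ).θ₅) ≤ (li F θ).C₀ ∧ 0 < (li F θ).A ∧
        (li F θ).θ₅ ≤ (li F θ).μ ∧ (li F θ).C₀ ≤ 2 * (li F θ).A ∧ 0 < (li F θ).r ∧ 0 < (li F θ).s ∧ (li F θ).s < 1 ∧ 1 ≤ (li F θ).μ)
    (hstrip : ∀ (F : T4Family) (θ : Stage13HParams F 2), θ.Provisos₁₃CoPH F 2 → (θ.ZhUnity F 2 ∧ θ.SlotsNondegenerate₁₃ F 2) → θ.Admissible F 2 → ∀ (k : ℕ),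
      ∀ (j : ℕ) (g : ℕ → ℝ), g ∈ Window θ.γ → ∀ (i : ℕ) (Y : (domSys (F.P k) θ.τ9.M j).Dom) (ψ : CPair (F.P k) (MatA 2)), ψ ∈ sp F θ k j Y →
        ∃ (Ec : ℂ → ℂ) (O : Set ℂ), IsOpen O ∧ (∀ t ∈ Ioc (0 : ℝ) θ.γ, closedBall (t : ℂ) (li F θ).r ⊆ O) ∧ DifferentiableOn ℂ Ec O ∧
          (∀ z ∈ O, ‖Ec z‖ ≤ (li F θ).A * Real.exp (-((li F θ).κ * torusTreeLen Y.1))) ∧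
          (∀ t ∈ Ioc (0 : ℝ) θ.γ, Ec t = termC (S F θ k) j Y (Function.update g i t) ψ))
    (hD4 : ∀ (F : T4Family) (θ : Stage13HParams F 2) (hP : θ.Provisos₁₃CoPH F 2), (θ.ZhUnity F 2 ∧ θ.SlotsNondegenerate₁₃ F 2) → θ.Admissible F 2 → ∀ k : ℕ,
      ReadOutAt (datumOfRecord₁₃CoPH F 2 θ hP) (u3OfRecord₁₃ θ.toStage13Params
        ((ReadingData.ofRecordAdm F θ.τ9.M 2 (S F θ) (sp F θ) (gauge F θ) (hg F θ) (T₀ F θ) (hT₀ F θ) (li F θ)).u3Objects θ.γ) k))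
    (hU : ∀ (F : T4Family) (θ : Stage13HParams F 2), θ.Provisos₁₃CoPH F 2 → ((θ.ZhUnity F 2 ∧ θ.SlotsNondegenerate₁₃ F 2) ∧ θ.ppSel = ppSelLiveOfRecord F 2 θ.ν θ.τ9 (EOfRecord₁₃ F 2 θ.toStage13Params) (wOfRecord₉ F 2 θ.toStage9Params)) → θ.Admissible F 2 → LocalBgMeasurable F 2 θ.ν)
    (hζm : ∀ (F : T4Family) (θ : Stage13HParams F 2), θ.Provisos₁₃CoPH F 2 → ((θ.ZhUnity F 2 ∧ θ.SlotsNondegenerate₁₃ F 2) ∧ θ.ppSel = ppSelLiveOfRecord F 2 θ.ν θ.τ9 (EOfRecord₁₃ F 2 θ.toStage13Params) (wOfRecord₉ F 2 θ.toStage9Params)) → θ.Admissible F 2 → ZetaMeasurable F 2 θ.ζ)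
    (hζ0 : ∀ (F : T4Family) (θ : Stage13HParams F 2), θ.Provisos₁₃CoPH F 2 → ((θ.ZhUnity F 2 ∧ θ.SlotsNondegenerate₁₃ F 2) ∧ θ.ppSel = ppSelLiveOfRecord F 2 θ.ν θ.τ9 (EOfRecord₁₃ F 2 θ.toStage13Params) (wOfRecord₉ F 2 θ.toStage9Params)) → θ.Admissible F 2 →
      ∀ p g k s Pl Ql RS U V', 0 ≤ θ.ζ p g k s Pl Ql RS U V')
    (h20 : ∀ (F : T4Family) (θ : Stage13HParams F 2) (hP : θ.Provisos₁₃CoPH F 2), ((θ.ZhUnity F 2 ∧ θ.SlotsNondegenerate₁₃ F 2) ∧ θ.ppSel = ppSelLiveOfRecord F 2 θ.ν θ.τ9 (EOfRecord₁₃ F 2 θ.toStage13Params) (wOfRecord₉ F 2 θ.toStage9Params)) → θ.Admissible F 2 → ∀ (g₀ : ℕ → ℝ) (os : List (ULoop F)),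
      ∃ W : ℕ → ℝ, RelWeightBound 1 (classSet₁₃ θ K₀ g₀) (weightA₁₃ θ hP K₀ g₀ os) (weightB₁₃ θ hP K₀ g₀ os) (badClass₁₃ θ K₀ g₀ jcut) W)
    (h21 : ∀ (F : T4Family) (θ : Stage13HParams F 2) (hP : θ.Provisos₁₃CoPH F 2), ((θ.ZhUnity F 2 ∧ θ.SlotsNondegenerate₁₃ F 2) ∧ θ.ppSel = ppSelLiveOfRecord F 2 θ.ν θ.τ9 (EOfRecord₁₃ F 2 θ.toStage13Params) (wOfRecord₉ F 2 θ.toStage9Params)) → θ.Admissible F 2 → ∀ (g₀ : ℕ → ℝ) (os : List (ULoop F)),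
      ∃ Wsh : ℕ → ℝ, ShellWeightBound 1 (classSet₁₃ θ K₀ g₀) (weightA₁₃ θ hP K₀ g₀ os) (weightB₁₃ θ hP K₀ g₀ os) (sh F θ hP g₀ os).1 (sh F θ hP g₀ os).2 Wsh)
    (h19 : ∀ (ℓ₃ : T4Family → NE3Letters₁₁) (F : T4Family) (θ : Stage13HParams F 2) (hP : θ.Provisos₁₃CoPH F 2), ((θ.ZhUnity F 2 ∧ θ.SlotsNondegenerate₁₃ F 2) ∧ θ.ppSel = ppSelLiveOfRecord F 2 θ.ν θ.τ9 (EOfRecord₁₃ F 2 θ.toStage13Params) (wOfRecord₉ F 2 θ.toStage9Params)) → θ.Admissible F 2 → ∀ (g₀ : ℕ → ℝ) (os : List (ULoop F)),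
      (∀ k : ℕ, RatesHolderAt (datumOfRecord₁₃CoPH F 2 θ hP) (rateCarriersOfRecord₁₃CoPH (readingOfRecord₁₃CoPH
        (fun F θ => ReadingData.ofRecordAdm F θ.τ9.M 2 (S F θ) (sp F θ) (gauge F θ) (hg F θ) (T₀ F θ) (hT₀ F θ) (li F θ)) ℓ₃ ne2 ne1) F θ hP g₀ os k) β) →
        letI : DecidableEq (Σ K, SiteSeqKey F (K₀ + K)) := Classical.decEq _
        ∃ δ : ℕ → ℝ, NE7.Core 1 (F.side ^ 4) (classSet₁₃ θ K₀ g₀) (badClass₁₃ θ K₀ g₀ jcut) (fun K t x => weightA₁₃ θ hP K₀ g₀ os K t x - (sh F θ hP g₀ os).1 K t x)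
          (fun K t x => weightB₁₃ θ hP K₀ g₀ os K t x - (sh F θ hP g₀ os).2 K t x) δ ∧ Summable δ)
    (h20' : ∀ (F : T4Family) (θ : Stage13HParams F 2) (hP : θ.Provisos₁₃CoPH F 2), ((θ.ZhUnity F 2 ∧ θ.SlotsNondegenerate₁₃ F 2) ∧ ¬ θ.ppSel = ppSelLiveOfRecord F 2 θ.ν θ.τ9 (EOfRecord₁₃ F 2 θ.toStage13Params) (wOfRecord₉ F 2 θ.toStage9Params)) → θ.Admissible F 2 → ∀ (g₀ : ℕ → ℝ) (os : List (ULoop F)),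
      RelWeightBound (cr' F θ hP g₀ os).l₀ (cr' F θ hP g₀ os).T (cr' F θ hP g₀ os).A (cr' F θ hP g₀ os).B (cr' F θ hP g₀ os).Bad (cr' F θ hP g₀ os).W)
    (h21' : ∀ (F : T4Family) (θ : Stage13HParams F 2) (hP : θ.Provisos₁₃CoPH F 2), ((θ.ZhUnity F 2 ∧ θ.SlotsNondegenerate₁₃ F 2) ∧ ¬ θ.ppSel = ppSelLiveOfRecord F 2 θ.ν θ.τ9 (EOfRecord₁₃ F 2 θ.toStage13Params) (wOfRecord₉ F 2 θ.toStage9Params)) → θ.Admissible F 2 → ∀ (g₀ : ℕ → ℝ) (os : List (ULoop F)),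
      ShellWeightBound (cr' F θ hP g₀ os).l₀ (cr' F θ hP g₀ os).T (cr' F θ hP g₀ os).A (cr' F θ hP g₀ os).B (cr' F θ hP g₀ os).shA (cr' F θ hP g₀ os).shB
        (cr' F θ hP g₀ os).Wsh)
    (hx' : ∀ (F : T4Family) (θ : Stage13HParams F 2) (hP : θ.Provisos₁₃CoPH F 2), ((θ.ZhUnity F 2 ∧ θ.SlotsNondegenerate₁₃ F 2) ∧ ¬ θ.ppSel = ppSelLiveOfRecord F 2 θ.ν θ.τ9 (EOfRecord₁₃ F 2 θ.toStage13Params) (wOfRecord₉ F 2 θ.toStage9Params)) → θ.Admissible F 2 →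
      B16.EndStatementBPrinted (datumOfRecord₁₃CoPH F 2 θ hP).C → DagBinding.EndpointExistence (datumOfRecord₁₃CoPH F 2 θ hP).C.toB12 →
        ForSmallCouplings (datumOfRecord₁₃CoPH F 2 θ hP) fun g₀ => ∀ os : List (ULoop F),
          0 < (cr' F θ hP g₀ os).l₀ ∧ 0 < (cr' F θ hP g₀ os).vol ∧
          (∀ (K : ℕ) (t : ℝ), |t| ≤ (cr' F θ hP g₀ os).l₀ →
            T4GenFunBounds.schemeZ ((datumOfRecord₁₃CoPH F 2 θ hP).scheme g₀) os ((cr' F θ hP g₀ os).K₀ + K) t =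
              ∑ τ ∈ (cr' F θ hP g₀ os).T K, (cr' F θ hP g₀ os).A K t τ) ∧
          (∀ (K : ℕ) (t : ℝ), |t| ≤ (cr' F θ hP g₀ os).l₀ →
            T4GenFunBounds.schemeZ ((datumOfRecord₁₃CoPH F 2 θ hP).scheme g₀) os ((cr' F θ hP g₀ os).K₀ + K + 1) t =
              ∑ τ ∈ (cr' F θ hP g₀ os).T K, (cr' F θ hP g₀ os).B K t τ))
    (h19' : ∀ (ℓ₃ : T4Family → NE3Letters₁₁) (F : T4Family) (θ : Stage13HParams F 2) (hP : θ.Provisos₁₃CoPH F 2), ((θ.ZhUnity F 2 ∧ θ.SlotsNondegenerate₁₃ F 2) ∧ ¬ θ.ppSel = ppSelLiveOfRecord F 2 θ.ν θ.τ9 (EOfRecord₁₃ F 2 θ.toStage13Params) (wOfRecord₉ F 2 θ.toStage9Params)) → θ.Admissible F 2 → ∀ (g₀ : ℕ → ℝ) (os : List (ULoop F)),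
      (∀ k : ℕ, RatesHolderAt (datumOfRecord₁₃CoPH F 2 θ hP) (rateCarriersOfRecord₁₃CoPH (readingOfRecord₁₃CoPH
        (fun F θ => ReadingData.ofRecordAdm F θ.τ9.M 2 (S F θ) (sp F θ) (gauge F θ) (hg F θ) (T₀ F θ) (hT₀ F θ) (li F θ)) ℓ₃ ne2 ne1) F θ hP g₀ os k) β) →
        letI := (cr' F θ hP g₀ os).dec
        ∃ δ : ℕ → ℝ, NE7.Core (cr' F θ hP g₀ os).l₀ (cr' F θ hP g₀ os).vol (cr' F θ hP g₀ os).T (cr' F θ hP g₀ os).Bad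
          (fun K t τ => (cr' F θ hP g₀ os).A K t τ - (cr' F θ hP g₀ os).shA K t τ) (fun K t τ => (cr' F θ hP g₀ os).B K t τ - (cr' F θ hP g₀ os).shB K t τ) δ ∧
          Summable δ)
    (hne2 : ∀ (F : T4Family) (θ : Stage13HParams F 2), θ.Provisos₁₃CoPH F 2 → θ.Admissible F 2 → ∀ (g₀ : ℕ → ℝ) (os : List (ULoop F)) (k : ℕ),
      ne2 F θ g₀ os k = haveI := neZero_blockFactor F; c2BgObjects 3 F.hL b aS α α' c35 p)
    (hne1 : ∀ (F : T4Family) (θ : Stage13HParams F 2) (hP : θ.Provisos₁₃CoPH F 2), θ.Admissible F 2 → ∀ (g₀ : ℕ → ℝ) (os : List (ULoop F)),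
      ne1 F θ g₀ os = ne1UnitScale l₀ M Λ hM F θ hP g₀ os) :
    SpineGivenEndpointR13SepCoPH :=
  fun F θ hP hG hθ _ _ =>
    (spine_rec13CCoPHOn_iff_forall_guarded (fun F θ => θ.ZhUnity F 2 ∧ θ.SlotsNondegenerate₁₃ F 2)).mp
      (spine_rec13CCoPHOn_of_split (fun F θ => θ.ZhUnity F 2 ∧ θ.SlotsNondegenerate₁₃ F 2)
        (fun F (θ : Stage13HParams F 2) => θ.ppSel = ppSelLiveOfRecord F 2 θ.ν θ.τ9 (EOfRecord₁₃ F 2 θ.toStage13Params) (wOfRecord₉ F 2 θ.toStage9Params))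
        (spine_rec13CCoPHOn_atBothReadingsOfRecord₁₃CoPHV_holder K₀ jcut sh hβ0 hβ1 (hg₃ := hg₃) (hD := hD) (h7 := h7) (S := S) (sp := sp)
          (gauge := gauge) (hg := hg) (T₀ := T₀) (hT₀ := hT₀) (li := li) (ne2 := ne2) (ne1 := ne1)
          (fun F θ => (θ.ZhUnity F 2 ∧ θ.SlotsNondegenerate₁₃ F 2) ∧ θ.ppSel = ppSelLiveOfRecord F 2 θ.ν θ.τ9 (EOfRecord₁₃ F 2 θ.toStage13Params) (wOfRecord₉ F 2 θ.toStage9Params))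
          hl₀ hM hΛ hb haS hc35 α α' p (fun F θ hP hRg hθ => h18 F θ hP hRg.1 hθ) (fun F θ hP hRg hθ => hjunk F θ hP hRg.1 hθ) (fun F θ hP hRg hθ => hnum F θ hP hRg.1 hθ)
          (fun F θ hP hRg hθ => hstrip F θ hP hRg.1 hθ) (fun F θ hP hRg hθ => hD4 F θ hP hRg.1 hθ) (fun _ _ _ hRg _ => ⟨_, hRg.2⟩) hU hζm hζ0 h20 h21 h19 hne2 hne1)
        (spine_rec13CCoPHOn_at_readingAdm₁₃CoPH_holder_of_unitScaleN14_c2Bg_thm33Letters (cr := cr') hβ0 hβ1 (hg₃ := hg₃) (hD := hD) (h7 := h7) (S := S) (sp := sp)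
          (gauge := gauge) (hg := hg) (T₀ := T₀) (hT₀ := hT₀) (li := li) (ne2 := ne2) (ne1 := ne1)
          (fun F θ => (θ.ZhUnity F 2 ∧ θ.SlotsNondegenerate₁₃ F 2) ∧ ¬ θ.ppSel = ppSelLiveOfRecord F 2 θ.ν θ.τ9 (EOfRecord₁₃ F 2 θ.toStage13Params) (wOfRecord₉ F 2 θ.toStage9Params))
          hl₀ hM hΛ hb haS hc35 α α' p (fun F θ hP hRg hθ => h18 F θ hP hRg.1 hθ) (fun F θ hP hRg hθ => hjunk F θ hP hRg.1 hθ) (fun F θ hP hRg hθ => hnum F θ hP hRg.1 hθ)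
          (fun F θ hP hRg hθ => hstrip F θ hP hRg.1 hθ) (fun F θ hP hRg hθ => hD4 F θ hP hRg.1 hθ)
          ((s_N20_sRec₁₃CoPHOn_iff cr' _).mpr h20') (by
            rintro F D g₀ os S' ⟨θ, hP, hRg, hθ, -, rfl⟩
            exact h21' F θ hP hRg hθ g₀ os)
          hx' h19' hne2 hne1))
      F θ hP.toCore hG hθ

end Summit.QuantumFields.YangMills.Theorems.BalabanUVNodesN27SpineRecord
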